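import Summits.PneNP.Statement
import Summits.PneNP.PneNP.Theses.ProofCplx
import Summits.PneNP.PneNP.Theorems.ProofCplxAssembly
import Literature.Computability.Complexity.NondeterministicProofs
import Literature.Computability.Complexity.ClayProblemProofs

/-!
# Route ProofCplx — `ProofcplxNpNeCoNpBridge` (item `stmt-PneNP-1046`)

The model bridge `NP ≠ coNP → PneNP` over the tree's classes (Cook's Clay statement `PneNP` over
Mathlib `TM2`; Arora–Barak 2009, §2.6.1: if `P = NP` then `coNP = co P = P = NP`). It is the
landed assembly theorem `Literature.CplxMeta.proofcplx_assembly`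
(`Theorems/ProofCplxAssembly.lean`) with its four named-fact hypotheses discharged by the tree's
proofs `P_subset_NP_holds`, `P_bool_eq_holds`, `NP_bool_eq_holds`, `co_P_holds`; hence
unconditional (axioms `propext`, `Classical.choice`, `Quot.sound`).

Prover prover-PneNP-route-PneNP-ExpanderLinearGenerators-3, 2026-08-16.
-/

set_option linter.dupNamespace false -- `Summit.PneNP.PneNP.…`: summit = sub-problem name (D-0017 single-conjunct layout)

namespace Summit.PneNP.PneNP.Theorems

open Literature.Computability.Complexity

/-- **Item `stmt-PneNP-1046`** (`ProofcplxNpNeCoNpBridge`, support of route ProofCplx):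
`NP ≠ coNP → PneNP`. If `P = NP` then `coNP = co P = P = NP` (Arora–Barak 2009, §2.6.1);
assembled from `Literature.CplxMeta.proofcplx_assembly` and the discharged facts `P ⊆ NP`,
`PNP.P Bool = P`, `PNP.NP Bool = NP`, `co P = P`. [cite: AroraBarakCC2009, §2.6.1] -/
theorem proofcplx_npNeCoNpBridge_proof :
    Summit.PneNP.PneNP.Theses.ProofCplx.ProofcplxNpNeCoNpBridge := by
  unfold Summit.PneNP.PneNP.Theses.ProofCplx.ProofcplxNpNeCoNpBridge
  exact Literature.CplxMeta.proofcplx_assembly P_subset_NP_holds P_bool_eq_holds NP_bool_eq_holds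
    co_P_holds

end Summit.PneNP.PneNP.Theorems
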